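import Mathlib.LinearAlgebra.Matrix.Determinant.Basic
import Mathlib.RingTheory.Extension.Cotangent.Basic
import Mathlib.RingTheory.Extension.Presentation.Basic
import Mathlib.RingTheory.Etale.Kaehler
import Mathlib.RingTheory.Smooth.Basic
import Mathlib.RingTheory.Flat.Localization
import Mathlib.Algebra.Module.StablyFree.Basic
import Mathlib.RingTheory.Finiteness.Prod
import Mathlib.LinearAlgebra.TensorProduct.Prod
import Mathlib.LinearAlgebra.TensorProduct.Pi
import Mathlib.RingTheory.Localization.BaseChange
import Literature.AlgebraicGeometry.Resolution.StrictlyStandardElements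
import HarnessLib

/-!
# Powers of `a` are strictly standard when `A_a` is smooth (Stacks 07EZ (e))

Topic: `Literature/AlgebraicGeometry/Resolution`. The Stacks Project, *Smoothing Ring Maps*
(Tag 07BW), Lemma 07EZ (= Lemma 16.3.7), part (e), for the notion of strictly standard
elements of Definition 07C7 (`IsStrictlyStandard`, `StrictlyStandardElements.lean`):

> **Lemma 07EZ.** Let `R → A` be a ring map of finite presentation. Let `a ∈ A`. Consider the
> following conditions on `a`: (1) `A_a` is smooth over `R`, (2) `A_a` is smooth over `R` and
> `Ω_{A_a/R}` is stably free, (3) `A_a` is smooth over `R` and `Ω_{A_a/R}` is free, (4) `A_a`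
> is standard smooth over `R`, (5) `a` is strictly standard in `A` over `R`, (6) `a` is
> elementary standard in `A` over `R`. Then … (e) (2) ⇒ the elements `a^e`, `e ≥ e_0` are
> strictly standard in `A` over `R` …

This is the step "`C_{x_i}` is a smooth `R`-algebra with `Ω_{C_{x_i}/R}` free. Hence we can find
`c > 0` such that `x_i^c` is strictly standard in `C/R`, see Lemma 07EZ" of the proof of
Lemma 07FE (`Stacks07FE_resolveSpecial`, `NeronPopescuSteps.lean`).

## Main statements

* `Stacks07EZ_isStrictlyStandard_pow` — 07EZ (e): `A` of finite presentation over `R`, `A_a`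
  formally smooth over `R` (equivalently smooth, `A_a` being of finite presentation) and
  `Ω_{A_a/R}` stably free ⇒ `∃ e₀, ∀ e ≥ e₀, IsStrictlyStandard R (a ^ e)`.
* `Stacks07EZ_isStrictlyStandard_pow_of_free` — the form (3) ⇒ (e) used in 07FE.
* `pow_eq_sum_minors_of_mul_eq` — Algebra, Lemma 07DQ (2) (Cauchy–Binet): `ψ · J = t · 1`
  implies that `t^c` is a combination of the `c × c` minors of `J` (the converse direction of
  Lemma 07ET).

## Proof (Stacks, proof of 07EZ (e)), and its rendering

Stacks: choose a presentation `A = R[x_1, …, x_n]/I`; the sequence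
`0 → (I/I²)_a → ⊕ A_a dx_i → Ω_{A_a/R} → 0` is split exact; hence `(I/I²)_a` is stably free;
adding variables `x_{n+1}, …, x_{n+r}` with `J = (I, x_{n+1}, …, x_{n+r})` makes `(J/J²)_a`
free; choose `f_1, …, f_c ∈ J` mapping to a basis of `(J/J²)_a` and extend to generators
`f_1, …, f_m` of `J`; then (16.2.3.4) holds for `a^e`, `e ≫ 0`, and a left inverse of
`(J/J²)_a → ⊕ A_a dx_i`, written in the basis and with denominators cleared, gives
`ψ₀ : A^{n+r} → A^c` with `ψ₀ ∘ d ∘ (f_1, …, f_c) = a^{e₀}`, whence (16.2.3.3) for `a^{ce₀}`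
by Lemma 07ET.

Rendering: for generators `G` of `A` (Mathlib `Algebra.Generators`, conormal module
`G.toExtension.Cotangent = J/J²`, cotangent complex `J/J² → ⊕ A dx_i`) we work with
`LocCot G a = A_a ⊗_A J/J²`. Section B proves the localized sequence exact (flat base change),
left injective (`H¹(L_{A/R})_a = H¹(L_{A_a/R}) = 0`, Mathlib `H1Cotangent.isLocalizedModule`)
and split (`A_a ⊗ Ω_{A/R} ≅ Ω_{A_a/R}` projective), giving the left inverse (`exists_sigma`:
`f̄ = ∑_i (∂f/∂x_i) σ_i`) and `(J/J²)_a ⊕ (A_a ⊗ Ω_{A/R}) ≅ A_a^n`. Section C deduces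
`(I/I²)_a ⊕ A_a^r` free from stable freeness of `Ω`. Section D constructs the generators with
`r` dummy variables (`extendZero`) and the isomorphism `J'/J'² ≅ J/J² ⊕ A^r`
(`cotExtendEquiv`; Taylor expansion in the dummy variables). Section E clears denominators
(`exists_pow_mul_mem_span_sup` = (16.2.3.4), `exists_matrix_mul_jacobian` = the matrix `ψ`)
and assembles the presentation `R[x_1, …, x_{n+r}]/(f_1, …, f_c, g_1, …, g_t)`; the nilpotent
case `A_a = 0` is `isStrictlyStandard_pow_of_isNilpotent` (`0` is strictly standard, `c = 0`).
Mathlib has no strictly standard elements; its `Algebra.Generators.exists_presentation_of_free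
_cotangent` (Stacks 07CF) is the analogous statement for a *free* conormal module without
localization, which is not what 07EZ needs.

## References

* The Stacks Project, *Smoothing Ring Maps* (Tag 07BW): Lemma 07EZ (16.3.7) (e) and its proof;
  Definition 07C7; Lemma 07ET; *Commutative Algebra*, Lemma 07DQ (2). [StacksProject]
* R. Elkik, *Solutions d'équations à coefficients dans un anneau hensélien*, Ann. Sci. ÉNS 6
  (1973) 553–603, §0.2. [cited through StacksProject]
* R. G. Swan, *Néron–Popescu desingularization*, in: Algebra and Geometry (Taipei 1995),
  Int. Press 1998, §§11–12 (strictly standard elements). [cited through StacksProject]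
-/

noncomputable section

open MvPolynomial TensorProduct

namespace Literature.AlgebraicGeometry.Resolution

universe u

/-! ## A. Cauchy–Binet expansion (Stacks 07DQ (2), the converse direction of 07ET) -/

section MatrixPart

variable {T : Type*} [CommRing T]

/-- Expansion of `det (A * B)` over all selections `p : Fin k → ι`. [folklore] -/
theorem det_mul_eq_sum_sel {k : ℕ} {ι : Type*} [Fintype ι] [DecidableEq ι]
    (A : Matrix (Fin k) ι T) (B : Matrix ι (Fin k) T) :
    (A * B).det = ∑ p : Fin k → ι, (∏ i, B (p i) i) * (A.submatrix id p).det := by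
  simp only [Matrix.det_apply', Matrix.mul_apply, Finset.prod_univ_sum, Finset.mul_sum,
    Fintype.piFinset_univ]
  rw [Finset.sum_comm]
  refine Finset.sum_congr rfl fun p _ => ?_
  refine Finset.sum_congr rfl fun σ _ => ?_
  simp only [Matrix.submatrix_apply, id, Finset.prod_mul_distrib]
  ring

/-- **Stacks 07DQ (2)** in the form needed for (16.2.3.3): if `ψ · J = t · 1` for a `c × ι`
matrix `ψ` and a `ι × c` matrix `J`, then `t ^ c` is a linear combination of the `c × c` minors
`det (J (p i) j)_{i,j}` of `J`, `p : Fin c → ι`. [cite: StacksProject, Tag 07DQ] -/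
theorem pow_eq_sum_minors_of_mul_eq {c : ℕ} {ι : Type*} [Fintype ι] [DecidableEq ι]
    (ψ : Matrix (Fin c) ι T) (J : Matrix ι (Fin c) T) (t : T)
    (h : ψ * J = t • (1 : Matrix (Fin c) (Fin c) T)) :
    t ^ c = ∑ p : Fin c → ι, (∏ i, ψ i (p i)) * (Matrix.of fun i j => J (p i) j).det := by
  have h1 : (ψ * J).det = t ^ c := by
    rw [h, Matrix.det_smul, Matrix.det_one, mul_one, Fintype.card_fin]
  have h2 : ∀ p : Fin c → ι, J.transpose.submatrix id p = (Matrix.of fun i j => J (p i) j).transpose := by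
    intro p; ext i j; rfl
  rw [← h1, ← Matrix.det_transpose, Matrix.transpose_mul, det_mul_eq_sum_sel]
  refine Finset.sum_congr rfl fun p _ => ?_
  rw [h2, Matrix.det_transpose]
  rfl

end MatrixPart

/-! ## B. The localized conormal sequence of a presentation -/

namespace Stacks07EZ

section Localized

variable {R A : Type u} [CommRing R] [CommRing A] [Algebra R A]
variable {ι : Type} (P : Algebra.Generators R A ι) (a : A)

/-- `(J/J²)_a` as `A_a ⊗_A J/J²`. [folklore] -/
abbrev LocCot : Type u := Localization.Away a ⊗[A] P.toExtension.Cotangent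

/-- The localized cotangent complex `(J/J²)_a → ⊕ A_a dx_i`. [folklore] -/
abbrev dL : LocCot P a →ₗ[Localization.Away a]
    Localization.Away a ⊗[A] P.toExtension.CotangentSpace :=
  (P.toExtension.cotangentComplex).baseChange (Localization.Away a)

/-- The localized map `⊕ A_a dx_i → A_a ⊗_A Ω_{A/R}`. [folklore] -/
abbrev gL : Localization.Away a ⊗[A] P.toExtension.CotangentSpace →ₗ[Localization.Away a]
    Localization.Away a ⊗[A] (Ω[A⁄R]) :=
  (P.toExtension.toKaehler).baseChange (Localization.Away a)

/-- The localized conormal sequence `(J/J²)_a → ⊕ A_a dx_i → A_a ⊗ Ω_{A/R}` is exact (flat base change of Mathlib's `exact_cotangentComplex_toKaehler`). [folklore] -/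
theorem exact_dL_gL : Function.Exact (dL P a) (gL P a) :=
  Module.Flat.lTensor_exact (Localization.Away a) P.toExtension.exact_cotangentComplex_toKaehler

/-- `⊕ A_a dx_i → A_a ⊗ Ω_{A/R}` is surjective. [folklore] -/
theorem gL_surjective : Function.Surjective (gL P a) :=
  LinearMap.lTensor_surjective _ P.toExtension.toKaehler_surjective

/-- `A_a ⊗ H¹(L_{A/R}) = H¹(L_{A_a/R}) = 0` when `A_a` is formally smooth over `R` (Stacks 07EZ, proof of (e): the localized sequence is exact on the left). [cite: StacksProject, Tag 07EZ] -/
theorem subsingleton_locH1 [Algebra.FormallySmooth R (Localization.Away a)] :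
    Subsingleton (Localization.Away a ⊗[A] P.toExtension.H1Cotangent) := by
  let e₁ : Localization.Away a ⊗[A] P.toExtension.H1Cotangent ≃ₗ[A]
      Localization.Away a ⊗[A] Algebra.H1Cotangent R A :=
    LinearEquiv.lTensor _ P.equivH1Cotangent
  let e₂ : Localization.Away a ⊗[A] Algebra.H1Cotangent R A ≃ₗ[A]
      Algebra.H1Cotangent R (Localization.Away a) :=
    IsLocalizedModule.linearEquiv (Submonoid.powers a)
      (TensorProduct.mk A (Localization.Away a) (Algebra.H1Cotangent R A) 1)
      (Algebra.H1Cotangent.map R R A (Localization.Away a))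
  exact (e₁.trans e₂).toEquiv.subsingleton

/-- `(J/J²)_a → ⊕ A_a dx_i` is injective when `A_a` is formally smooth (Stacks 07EZ, proof of (e): "we have a short exact sequence `0 → (I/I²)_a → ⊕ A_a dx_i → Ω_{A_a/R} → 0`"). [cite: StacksProject, Tag 07EZ] -/
theorem dL_injective [Algebra.FormallySmooth R (Localization.Away a)] :
    Function.Injective (dL P a) := by
  have h := Module.Flat.lTensor_exact (Localization.Away a)
    (P.toExtension.exact_hCotangentι_cotangentComplex)
  have hs := subsingleton_locH1 P a (R := R)
  rw [← LinearMap.ker_eq_bot, LinearMap.ker_eq_bot']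
  intro m hm
  obtain ⟨y, rfl⟩ := (h m).mp hm
  rw [Subsingleton.elim y 0, map_zero]

/-- `A_a ⊗_A Ω_{A/R} ≅ Ω_{A_a/R}` is projective when `A_a` is formally smooth. [folklore] -/
theorem projective_locKaehler [Algebra.FormallySmooth R (Localization.Away a)] :
    Module.Projective (Localization.Away a) (Localization.Away a ⊗[A] (Ω[A⁄R])) :=
  Module.Projective.of_equiv
    (IsLocalizedModule.isBaseChange (Submonoid.powers a) (Localization.Away a)
      (KaehlerDifferential.map R R A (Localization.Away a))).equiv.symm

/-- The localized conormal sequence splits: `(J/J²)_a → ⊕ A_a dx_i` has a left inverse (Stacks 07EZ, proof of (e): "which is split exact"). [cite: StacksProject, Tag 07EZ] -/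
theorem exists_retraction_dL [Algebra.FormallySmooth R (Localization.Away a)] :
    ∃ l : Localization.Away a ⊗[A] P.toExtension.CotangentSpace →ₗ[Localization.Away a]
      LocCot P a, l ∘ₗ dL P a = LinearMap.id := by
  have := projective_locKaehler a (R := R) (A := A)
  obtain ⟨s, hs⟩ := Module.projective_lifting_property (gL P a) LinearMap.id (gL_surjective P a)
  have h01 := (exact_dL_gL P a).split_tfae'.out 0 1
  obtain ⟨-, l, hl⟩ := h01.mp ⟨dL_injective P a, s, hs⟩
  exact ⟨l, hl⟩

/-- `(J/J²)_a ⊕ (A_a ⊗ Ω_{A/R}) ≅ ⊕ A_a dx_i` is free (Stacks 07EZ, proof of (e): "Hence we see that `(I/I²)_a ⊕ Ω_{A_a/R}` is a free `A_a`-module"). [cite: StacksProject, Tag 07EZ] -/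
theorem free_locCot_prod [Algebra.FormallySmooth R (Localization.Away a)] :
    Module.Free (Localization.Away a)
      (LocCot P a × (Localization.Away a ⊗[A] (Ω[A⁄R]))) := by
  have := projective_locKaehler a (R := R) (A := A)
  obtain ⟨s, hs⟩ := Module.projective_lifting_property (gL P a) LinearMap.id (gL_surjective P a)
  have h02 := (exact_dL_gL P a).split_tfae'.out 0 2
  obtain ⟨e, -, -⟩ := h02.mp ⟨dL_injective P a, s, hs⟩
  exact Module.Free.of_equiv e

end Localized

/-! ## C. Stably free Kähler differentials: `(J/J²)_a ⊕ A_a^r` is free for some `r` -/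

section StablyFree

variable {R A : Type u} [CommRing R] [CommRing A] [Algebra R A]
variable {ι : Type} [Finite ι] (P : Algebra.Generators R A ι) (a : A)

/-- If `Ω_{A_a/R}` is stably free then `(J/J²)_a ⊕ A_a^r` is free for some `r` (Stacks 07EZ, proof of (e): "Since `Ω_{A_a/R}` is stably free we see that `(I/I²)_a` is stably free as well"). [cite: StacksProject, Tag 07EZ] -/
theorem exists_free_locCot_prod_pi [Algebra.FormallySmooth R (Localization.Away a)]
    [Module.IsStablyFree (Localization.Away a) (Ω[Localization.Away a⁄R])]
    [Nontrivial (Localization.Away a)] :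
    ∃ r : ℕ, Module.Free (Localization.Away a)
      (LocCot P a × (Fin r → Localization.Away a)) := by
  haveI : Algebra.FiniteType R A := P.finiteType
  let eΩ : Localization.Away a ⊗[A] (Ω[A⁄R]) ≃ₗ[Localization.Away a]
      (Ω[Localization.Away a⁄R]) :=
    (IsLocalizedModule.isBaseChange (Submonoid.powers a) (Localization.Away a)
      (KaehlerDifferential.map R R A (Localization.Away a))).equiv
  haveI hsf : Module.IsStablyFree (Localization.Away a) (Localization.Away a ⊗[A] (Ω[A⁄R])) :=
    .equiv eΩ.symm
  obtain ⟨N, _, _, _, _, hfree⟩ :=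
    Module.IsStablyFree.exist_free_prod (Localization.Away a) (Localization.Away a ⊗[A] (Ω[A⁄R]))
  haveI := free_locCot_prod P a (R := R)
  haveI : Module.Free (Localization.Away a)
      (LocCot P a × ((Localization.Away a ⊗[A] (Ω[A⁄R])) × N)) :=
    Module.Free.of_equiv (LinearEquiv.prodAssoc (Localization.Away a) (LocCot P a)
      (Localization.Away a ⊗[A] (Ω[A⁄R])) N)
  haveI : Module.Finite A (Ω[A⁄R]) := inferInstance
  haveI : Module.Finite (Localization.Away a) (Localization.Away a ⊗[A] (Ω[A⁄R])) :=
    inferInstance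
  let b := Module.finBasis (Localization.Away a) ((Localization.Away a ⊗[A] (Ω[A⁄R])) × N)
  exact ⟨_, Module.Free.of_equiv ((LinearEquiv.refl (Localization.Away a) (LocCot P a)).prodCongr
    b.equivFun)⟩

end StablyFree

/-! ## D. Adding dummy generators: `J'/J'² ≅ J/J² ⊕ A^r` -/

section Extend

variable {R A : Type u} [CommRing R] [CommRing A] [Algebra R A]
variable {n : ℕ} (P : Algebra.Generators R A (Fin n)) (r : ℕ)

/-- `Fin.append v 0 ∘ Fin.castAdd = v`. [folklore] -/
theorem append_comp_castAdd : Fin.append P.val (0 : Fin r → A) ∘ Fin.castAdd r = P.val :=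
  funext fun i => Fin.append_left _ _ i

/-- The generators `P` together with `r` extra generators mapping to `0`
(Stacks 07EZ, proof of (e): "replacing the presentation by `R[x_1, …, x_{n+r}]/J` with
`J = (I, x_{n+1}, …, x_{n+r})`"). [cite: StacksProject, Tag 07EZ] -/
def extendZero : Algebra.Generators R A (Fin (n + r)) :=
  Algebra.Generators.ofSurjective (Fin.append P.val 0) fun s => by
    refine ⟨rename (Fin.castAdd r) (P.σ s), ?_⟩
    rw [aeval_rename, append_comp_castAdd, P.aeval_val_σ]

/-- Values of the extended generators. [folklore] -/
@[simp] theorem extendZero_val : (extendZero P r).val = Fin.append P.val 0 := rfl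

/-- The old generators keep their values. [folklore] -/
theorem extendZero_val_castAdd (i : Fin n) : (extendZero P r).val (Fin.castAdd r i) = P.val i := by
  simp

/-- The dummy generators map to `0`. [folklore] -/
theorem extendZero_val_natAdd (k : Fin r) : (extendZero P r).val (Fin.natAdd n k) = 0 := by
  simp

/-- `x_i ↦ x_i`. [folklore] -/
def inclHom : P.Hom (extendZero P r) where
  val i := X (Fin.castAdd r i)
  aeval_val i := by simp

/-- `x_i ↦ x_i` (`i ≤ n`), `x_{n+k} ↦ 0`. [folklore] -/
def projHom : (extendZero P r).Hom P where
  val := Fin.append X 0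
  aeval_val i := by
    refine Fin.addCases (fun i => ?_) (fun k => ?_) i
    · simp
    · simp

/-- Projection after inclusion is the identity. [folklore] -/
theorem projHom_comp_inclHom :
    (projHom P r).comp (inclHom P r) = Algebra.Generators.Hom.id P := by
  refine Algebra.Generators.Hom.ext (funext fun i => ?_)
  simp [projHom, inclHom]

/-- Projection after inclusion is the identity on polynomials. [folklore] -/
theorem projHom_toAlgHom_inclHom_toAlgHom (x : P.Ring) :
    (projHom P r).toAlgHom ((inclHom P r).toAlgHom x) = x := by
  rw [← Algebra.Generators.Hom.toAlgHom_comp_apply, projHom_comp_inclHom,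
    Algebra.Generators.Hom.toAlgHom_id, AlgHom.id_apply]

/-- `J/J² → J'/J'²`. [folklore] -/
abbrev inclCot : P.toExtension.Cotangent →ₗ[A] (extendZero P r).toExtension.Cotangent :=
  Algebra.Extension.Cotangent.map (inclHom P r).toExtensionHom

/-- `J'/J'² → J/J²`. [folklore] -/
abbrev projCot : (extendZero P r).toExtension.Cotangent →ₗ[A] P.toExtension.Cotangent :=
  Algebra.Extension.Cotangent.map (projHom P r).toExtensionHom

/-- `J/J² → J'/J'² → J/J²` is the identity. [folklore] -/
theorem projCot_inclCot (x : P.toExtension.Cotangent) : projCot P r (inclCot P r x) = x := by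
  have h := Algebra.Extension.Cotangent.map_comp (f := (inclHom P r).toExtensionHom)
    (g := (projHom P r).toExtensionHom)
  rw [← Algebra.Generators.Hom.toExtensionHom_comp, projHom_comp_inclHom,
    Algebra.Generators.Hom.toExtensionHom_id, Algebra.Extension.Cotangent.map_id] at h
  exact (LinearMap.congr_fun h x).symm

/-- The dummy variables lie in `J'`. [folklore] -/
theorem X_natAdd_mem_ker (k : Fin r) : (X (Fin.natAdd n k) : (extendZero P r).Ring) ∈
    (extendZero P r).ker := by
  rw [Algebra.Generators.ker_eq_ker_aeval_val, RingHom.mem_ker, aeval_X]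
  exact extendZero_val_natAdd P r k

/-- The classes `ȳ_k` of the extra variables in `J'/J'²`. [folklore] -/
def extraVar (k : Fin r) : (extendZero P r).toExtension.Cotangent :=
  Algebra.Extension.Cotangent.mk ⟨X (Fin.natAdd n k), X_natAdd_mem_ker P r k⟩

/-- `A^r → J'/J'²`, `e_k ↦ ȳ_k`. [folklore] -/
def extraMap : (Fin r → A) →ₗ[A] (extendZero P r).toExtension.Cotangent :=
  Fintype.linearCombination A (extraVar P r)

/-- Formula for `extraMap`. [folklore] -/
theorem extraMap_apply (v : Fin r → A) : extraMap P r v = ∑ k, v k • extraVar P r k :=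
  Fintype.linearCombination_apply _ _ _

/-- `J'/J'² → A^r`, `f̄ ↦ (∂f/∂x_{n+k} (val))_k`. [folklore] -/
def coordExtra : (extendZero P r).toExtension.Cotangent →ₗ[A] (Fin r → A) :=
  (Finsupp.linearEquivFunOnFinite A A (Fin r)).toLinearMap ∘ₗ
    (extendZero P r).cotangentRestrict (Fin.natAdd_injective r n)

/-- Formula for `coordExtra`. [folklore] -/
theorem coordExtra_mk (x : (extendZero P r).ker) (k : Fin r) :
    coordExtra P r (Algebra.Extension.Cotangent.mk x) k =
      aeval (extendZero P r).val (pderiv (Fin.natAdd n k) x.val) := by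
  simp only [coordExtra, LinearMap.coe_comp, LinearEquiv.coe_coe, Function.comp_apply,
    Finsupp.linearEquivFunOnFinite_apply]
  rw [Algebra.Generators.cotangentRestrict_mk]

/-- Dummy and old variable indices differ. [folklore] -/
theorem natAdd_ne_castAdd (k : Fin r) (i : Fin n) : Fin.natAdd n k ≠ Fin.castAdd r i := by
  intro h
  have := congrArg Fin.val h
  simp at this
  omega

/-- Polynomials in the old variables have zero derivative in the dummy variables. [folklore] -/
theorem pderiv_natAdd_inclHom (k : Fin r) (x : P.Ring) :
    pderiv (Fin.natAdd n k) ((inclHom P r).toAlgHom x) = 0 := by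
  induction x using MvPolynomial.induction_on with
  | C c => rw [Algebra.Generators.Hom.toAlgHom_C, pderiv_C]
  | add p q hp hq => rw [map_add, map_add, hp, hq, add_zero]
  | mul_X p i hp =>
    rw [map_mul, Algebra.Generators.Hom.toAlgHom_X, Derivation.leibniz, hp, smul_zero, add_zero]
    change (inclHom P r).toAlgHom p • pderiv (Fin.natAdd n k) (X (Fin.castAdd r i)) = 0
    rw [pderiv_X, Pi.single_eq_of_ne (natAdd_ne_castAdd (n := n) r k i).symm, smul_zero]

/-- `coordExtra` vanishes on the image of `J/J²`. [folklore] -/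
theorem coordExtra_inclCot (x : P.toExtension.Cotangent) : coordExtra P r (inclCot P r x) = 0 := by
  obtain ⟨y, rfl⟩ := Algebra.Extension.Cotangent.mk_surjective x
  rw [Algebra.Extension.Cotangent.map_mk]
  ext k
  rw [coordExtra_mk, Pi.zero_apply]
  change aeval _ (pderiv _ ((inclHom P r).toAlgHom y.val)) = 0
  rw [pderiv_natAdd_inclHom, map_zero]

/-- `coordExtra ȳ_k = e_k`. [folklore] -/
theorem coordExtra_extraVar (k : Fin r) : coordExtra P r (extraVar P r k) = Pi.single k 1 := by
  classical
  ext k'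
  rw [extraVar, coordExtra_mk]
  change aeval _ (pderiv (Fin.natAdd n k') (X (Fin.natAdd n k))) = _
  by_cases h : k = k'
  · subst h
    rw [pderiv_X, Pi.single_eq_same, Pi.single_eq_same, map_one]
  · have h' : Fin.natAdd n k ≠ Fin.natAdd n k' := fun e => h ((Fin.natAdd_inj n).mp e)
    rw [pderiv_X, Pi.single_eq_of_ne h', map_zero, Pi.single_eq_of_ne (Ne.symm h)]

/-- `coordExtra ∘ extraMap = id`. [folklore] -/
theorem coordExtra_extraMap (v : Fin r → A) : coordExtra P r (extraMap P r v) = v := by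
  rw [extraMap_apply, map_sum]
  ext k'
  simp only [map_smul, coordExtra_extraVar, Finset.sum_apply, Pi.smul_apply, Pi.single_apply,
    smul_eq_mul, mul_ite, mul_one, mul_zero, Finset.sum_ite_eq, Finset.mem_univ, if_true]

/-- The projection kills `ȳ_k`. [folklore] -/
theorem projCot_extraVar (k : Fin r) : projCot P r (extraVar P r k) = 0 := by
  rw [extraVar, Algebra.Extension.Cotangent.map_mk, Algebra.Extension.Cotangent.mk_eq_zero_iff]
  change (projHom P r).toAlgHom (X (Fin.natAdd n k)) ∈ _
  rw [Algebra.Generators.Hom.toAlgHom_X]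
  have h0 : (projHom P r).val (Fin.natAdd n k) = 0 := Fin.append_right _ _ k
  rw [h0]
  exact Submodule.zero_mem _

/-- The projection kills the image of `A^r`. [folklore] -/
theorem projCot_extraMap (v : Fin r → A) : projCot P r (extraMap P r v) = 0 := by
  rw [extraMap_apply, map_sum]
  exact Finset.sum_eq_zero fun k _ => by rw [map_smul, projCot_extraVar, smul_zero]

/-- Taylor expansion in the extra variables: `f - f(x, 0) ∈ (x_{n+1}, …, x_{n+r})`. [folklore] -/
theorem sub_inclproj_mem_span (f : (extendZero P r).Ring) :
    f - (inclHom P r).toAlgHom ((projHom P r).toAlgHom f) ∈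
      Ideal.span (Set.range fun k : Fin r => (X (Fin.natAdd n k) : (extendZero P r).Ring)) := by
  induction f using MvPolynomial.induction_on with
  | C c =>
    rw [Algebra.Generators.Hom.toAlgHom_C, Algebra.Generators.Hom.toAlgHom_C]
    simp
  | add p q hp hq =>
    rw [map_add, map_add, add_sub_add_comm]
    exact Ideal.add_mem _ hp hq
  | mul_X p i hp =>
    rw [map_mul, map_mul, Algebra.Generators.Hom.toAlgHom_X]
    induction i using Fin.addCases with
    | left i =>
      have h1 : (projHom P r).val (Fin.castAdd r i) = X i := Fin.append_left _ _ i
      rw [h1, Algebra.Generators.Hom.toAlgHom_X]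
      change p * X (Fin.castAdd r i) - _ * X (Fin.castAdd r i) ∈ _
      rw [← sub_mul]
      exact Ideal.mul_mem_right _ _ hp
    | right k =>
      have h1 : (projHom P r).val (Fin.natAdd n k) = 0 := Fin.append_right _ _ k
      rw [h1, map_zero, mul_zero, sub_zero]
      exact Ideal.mul_mem_left _ _ (Ideal.subset_span ⟨k, rfl⟩)

/-- The projection maps `J'` into `J`. [folklore] -/
theorem projHom_toAlgHom_mem_ker {f : (extendZero P r).Ring} (hf : f ∈ (extendZero P r).ker) :
    (projHom P r).toAlgHom f ∈ P.ker := by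
  rw [Algebra.Generators.ker_eq_ker_aeval_val, RingHom.mem_ker,
    Algebra.Generators.Hom.algebraMap_toAlgHom', Algebra.Generators.aeval_val_eq_zero hf]

/-- `J/J² ⊕ A^r → J'/J'²`. [folklore] -/
def prodToCot : (P.toExtension.Cotangent × (Fin r → A)) →ₗ[A]
    (extendZero P r).toExtension.Cotangent :=
  (inclCot P r).coprod (extraMap P r)

/-- `J'/J'² → J/J² ⊕ A^r`. [folklore] -/
def cotToProd : (extendZero P r).toExtension.Cotangent →ₗ[A]
    (P.toExtension.Cotangent × (Fin r → A)) :=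
  (projCot P r).prod (coordExtra P r)

/-- `cotToProd ∘ prodToCot = id`. [folklore] -/
theorem cotToProd_prodToCot (x : P.toExtension.Cotangent × (Fin r → A)) :
    cotToProd P r (prodToCot P r x) = x := by
  obtain ⟨x, v⟩ := x
  apply Prod.ext
  · change projCot P r (inclCot P r x + extraMap P r v) = x
    rw [map_add, projCot_inclCot, projCot_extraMap, add_zero]
  · change coordExtra P r (inclCot P r x + extraMap P r v) = v
    rw [map_add, coordExtra_inclCot, coordExtra_extraMap, zero_add]

/-- The `P`-action on `J/J²` in terms of representatives. [folklore] -/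
theorem smul_mk_eq {Q : Algebra.Extension R A} (p : Q.Ring) (x : Q.ker) :
    p • Algebra.Extension.Cotangent.mk x = Algebra.Extension.Cotangent.mk (p • x) :=
  (LinearMap.map_smul _ p x).symm

set_option backward.isDefEq.respectTransparency false in
/-- `J/J² ⊕ A^r → J'/J'²` is surjective (by the Taylor expansion in the dummy variables). [folklore] -/
theorem prodToCot_surjective : Function.Surjective (prodToCot P r) := by
  intro m
  obtain ⟨⟨f, hf⟩, rfl⟩ := Algebra.Extension.Cotangent.mk_surjective m
  obtain ⟨g, hg⟩ := (Ideal.mem_span_range_iff_exists_fun).mp (sub_inclproj_mem_span P r f)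
  have hpf : (projHom P r).toAlgHom f ∈ P.ker := projHom_toAlgHom_mem_ker P r hf
  have hipf : (inclHom P r).toAlgHom ((projHom P r).toAlgHom f) ∈ (extendZero P r).ker := by
    rw [Algebra.Generators.ker_eq_ker_aeval_val, RingHom.mem_ker,
      Algebra.Generators.Hom.algebraMap_toAlgHom', Algebra.Generators.aeval_val_eq_zero hpf]
  refine ⟨(Algebra.Extension.Cotangent.mk ⟨(projHom P r).toAlgHom f, hpf⟩,
    fun k => aeval (extendZero P r).val (g k)), ?_⟩
  rw [prodToCot, LinearMap.coprod_apply, Algebra.Extension.Cotangent.map_mk, extraMap_apply]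
  have hsum : ∑ k, aeval (extendZero P r).val (g k) • extraVar P r k =
      Algebra.Extension.Cotangent.mk (∑ k, g k • (⟨X (Fin.natAdd n k), X_natAdd_mem_ker P r k⟩ :
        (extendZero P r).ker)) := by
    rw [map_sum]
    refine Finset.sum_congr rfl fun k _ => ?_
    rw [← smul_mk_eq, extraVar, ← Algebra.Generators.algebraMap_apply, algebraMap_smul]
  rw [hsum, ← map_add]
  congr 1
  apply Subtype.ext
  rw [Submodule.coe_add, Submodule.coe_sum]
  simp_rw [Submodule.coe_smul, smul_eq_mul]
  change (inclHom P r).toAlgHom ((projHom P r).toAlgHom f) + ∑ k, g k * X (Fin.natAdd n k) = f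
  rw [hg]
  ring

/-- **`J'/J'² ≅ J/J² ⊕ A^r`** for the presentation with `r` dummy generators.
[cite: StacksProject, Tag 07EZ] -/
def cotExtendEquiv : (extendZero P r).toExtension.Cotangent ≃ₗ[A]
    (P.toExtension.Cotangent × (Fin r → A)) :=
  (LinearEquiv.ofBijective (prodToCot P r)
    ⟨(Function.LeftInverse.injective (g := cotToProd P r) (cotToProd_prodToCot P r)),
      prodToCot_surjective P r⟩).symm

variable (a : A)

/-- `(J'/J'²)_a ≅ (J/J²)_a ⊕ A_a^r`. [folklore] -/
def locCotExtendEquiv : LocCot (extendZero P r) a ≃ₗ[Localization.Away a]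
    (LocCot P a × (Fin r → Localization.Away a)) :=
  (LinearEquiv.baseChange A (Localization.Away a) _ _ (cotExtendEquiv P r)).trans
    ((TensorProduct.prodRight A (Localization.Away a) (Localization.Away a)
      P.toExtension.Cotangent (Fin r → A)).trans
      ((LinearEquiv.refl _ _).prodCongr
        (TensorProduct.piScalarRight A (Localization.Away a) (Localization.Away a) (Fin r))))

/-- `(J'/J'²)_a` is free as soon as `(J/J²)_a ⊕ A_a^r` is (Stacks 07EZ, proof of (e): "we get that `(J/J²)_a` is (finite) free"). [cite: StacksProject, Tag 07EZ] -/
theorem free_locCot_extendZero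
    (h : Module.Free (Localization.Away a) (LocCot P a × (Fin r → Localization.Away a))) :
    Module.Free (Localization.Away a) (LocCot (extendZero P r) a) :=
  Module.Free.of_equiv (locCotExtendEquiv P r a).symm

end Extend

/-! ## E. Assembly: Stacks 07EZ (e) -/

section Assembly

variable {R A : Type u} [CommRing R] [CommRing A] [Algebra R A]

/-- `0` is strictly standard (take `c = 0`). [folklore] -/
theorem isStrictlyStandard_zero [Algebra.FinitePresentation R A] :
    IsStrictlyStandard R (0 : A) := by
  obtain ⟨n, m, ⟨P⟩⟩ := Algebra.Presentation.exists_presentation_fin R A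
  refine ⟨n, m, P, 0, Nat.zero_le _, Nat.zero_le _, ⟨fun _ => 0, by simp⟩, ?_⟩
  intro p hp j _
  refine Ideal.mem_sup_right ?_
  rw [pow_two]
  refine Ideal.mul_mem_mul ?_ (P.relation_mem_ker j)
  rw [P.ker_eq_ker_aeval_val, RingHom.mem_ker, hp]

/-- Powers of a nilpotent element are eventually strictly standard. [folklore] -/
theorem isStrictlyStandard_pow_of_isNilpotent [Algebra.FinitePresentation R A] {a : A}
    (h : IsNilpotent a) : ∃ e₀ : ℕ, ∀ e, e₀ ≤ e → IsStrictlyStandard R (a ^ e) := by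
  obtain ⟨n, hn⟩ := h
  exact ⟨n, fun e he => by rw [pow_eq_zero_of_le he hn]; exact isStrictlyStandard_zero⟩

/-- A finite family of `a`-power torsion elements is killed by a single power of `a`. [folklore] -/
theorem exists_pow_mul_eq_zero_of_forall {κ : Type*} [Finite κ] (a : A) (Δ : κ → A)
    (h : ∀ k, ∃ n : ℕ, a ^ n * Δ k = 0) : ∃ n : ℕ, ∀ k, a ^ n * Δ k = 0 := by
  choose n hn using h
  haveI := Fintype.ofFinite κ
  refine ⟨∑ k, n k, fun k => ?_⟩
  have hle : n k ≤ ∑ k, n k := Finset.single_le_sum (fun _ _ => Nat.zero_le _) (Finset.mem_univ k)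
  rw [← Nat.sub_add_cancel hle, pow_add, mul_assoc, hn, mul_zero]

/-- The `A`-action on `J/J²` in terms of representatives. [folklore] -/
theorem smul_mk_eq_mk_σ_smul {Q : Algebra.Extension R A} (s : A) (z : Q.ker) :
    s • Algebra.Extension.Cotangent.mk z = Algebra.Extension.Cotangent.mk (Q.σ s • z) := by
  apply Algebra.Extension.Cotangent.ext
  rw [Algebra.Extension.Cotangent.val_smul, Algebra.Extension.Cotangent.val_mk,
    Algebra.Extension.Cotangent.val_mk, LinearMap.map_smul]

/-- `σ(s)^e - σ(s^e) ∈ J` for the chosen set-theoretic section `σ`. [folklore] -/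
theorem σ_pow_sub_σ_pow_mem_ker (Q : Algebra.Extension R A) (s : A) (e : ℕ) :
    Q.σ s ^ e - Q.σ (s ^ e) ∈ Q.ker := by
  change _ ∈ RingHom.ker (algebraMap Q.Ring A)
  rw [RingHom.mem_ker, map_sub, map_pow, Q.algebraMap_σ, Q.algebraMap_σ, sub_self]

variable {ι : Type} (G : Algebra.Generators R A ι) (a : A)

set_option backward.isDefEq.respectTransparency false in
/-- **(KEY)** The left inverse of the localized cotangent complex in coordinates: there are
`σ_i ∈ (J/J²)_a` with `f̄ = ∑_i (∂f/∂x_i) σ_i` for every `f ∈ J` (Stacks 07EZ, proof of (e):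
"since `(J/J²)_a → ⊕ A_a dx_i` is a split injection we can find an `A_a`-linear left
inverse"). [cite: StacksProject, Tag 07EZ] -/
theorem exists_sigma [Fintype ι] [Algebra.FormallySmooth R (Localization.Away a)] :
    ∃ σ : ι → LocCot G a, ∀ z : G.toExtension.ker,
      (1 : Localization.Away a) ⊗ₜ[A] Algebra.Extension.Cotangent.mk z =
        ∑ i, algebraMap A (Localization.Away a) (aeval G.val (pderiv i z.val)) • σ i := by
  obtain ⟨l, hl⟩ := exists_retraction_dL G a (R := R)
  let bS := G.cotangentSpaceBasis.baseChange (Localization.Away a)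
  refine ⟨fun i => l (bS i), fun z => ?_⟩
  have h1 : (1 : Localization.Away a) ⊗ₜ[A] Algebra.Extension.Cotangent.mk z =
      l (dL G a ((1 : Localization.Away a) ⊗ₜ[A] Algebra.Extension.Cotangent.mk z)) := by
    rw [← LinearMap.comp_apply, hl, LinearMap.id_apply]
  rw [h1, ← bS.sum_repr (dL G a ((1 : Localization.Away a) ⊗ₜ[A]
    Algebra.Extension.Cotangent.mk z)), map_sum]
  refine Finset.sum_congr rfl fun i _ => ?_
  rw [map_smul]
  congr 1
  rw [LinearMap.baseChange_tmul, Algebra.Extension.cotangentComplex_mk,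
    Module.Basis.baseChange_repr_tmul, Algebra.Generators.cotangentSpaceBasis_repr_one_tmul,
    Algebra.smul_def, mul_one]

set_option backward.isDefEq.respectTransparency false in
/-- Clearing denominators in a basis expansion: if the `1 ⊗ x̄_k` form a basis of `(J/J²)_a`,
then for `f ∈ J` some `σ(a)^e f` lies in `(x_1, …, x_c) + J²` (this gives (16.2.3.4) for
`a^e`). [cite: StacksProject, Tag 07EZ] -/
theorem exists_pow_mul_mem_span_sup {c : ℕ} (x : Fin c → G.toExtension.ker)
    (b : Module.Basis (Fin c) (Localization.Away a) (LocCot G a))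
    (hb : ∀ k, b k = (1 : Localization.Away a) ⊗ₜ[A] Algebra.Extension.Cotangent.mk (x k))
    (f : G.toExtension.Ring) (hf : f ∈ G.toExtension.ker) :
    ∃ E : ℕ, ∀ e, E ≤ e → G.toExtension.σ a ^ e * f ∈
      Ideal.span (Set.range fun k => (x k).val) ⊔ G.toExtension.ker ^ 2 := by
  set y : G.toExtension.Cotangent := Algebra.Extension.Cotangent.mk ⟨f, hf⟩ with hy
  obtain ⟨s, hs⟩ := IsLocalization.exist_integer_multiples_of_finite (Submonoid.powers a)
    (fun k => b.repr ((1 : Localization.Away a) ⊗ₜ[A] y) k)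
  choose u hu using fun k => RingHom.mem_rangeS.mp (hs k)
  -- `s • (1 ⊗ y) = 1 ⊗ ∑ u_k • x̄_k`
  have h1 : (1 : Localization.Away a) ⊗ₜ[A]
      ((s : A) • y - ∑ k, u k • Algebra.Extension.Cotangent.mk (x k)) = 0 := by
    rw [tmul_sub, tmul_smul, tmul_sum, ← b.sum_repr ((1 : Localization.Away a) ⊗ₜ[A] y),
      Finset.smul_sum, sub_eq_zero]
    refine Finset.sum_congr rfl fun k _ => ?_
    rw [← smul_assoc, ← hu k, algebraMap_smul, hb k, tmul_smul]
  obtain ⟨s', hs'⟩ := (IsLocalizedModule.eq_zero_iff (Submonoid.powers a)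
    (TensorProduct.mk A (Localization.Away a) G.toExtension.Cotangent 1)).mp h1
  obtain ⟨e2, he2⟩ := (Submonoid.mem_powers_iff _ _).mp s.2
  obtain ⟨e3, he3⟩ := (Submonoid.mem_powers_iff _ _).mp s'.2
  -- translate into the polynomial ring
  have h2 : (a ^ (e3 + e2)) • y =
      ∑ k, (a ^ e3 * u k) • Algebra.Extension.Cotangent.mk (x k) := by
    rw [Submonoid.smul_def, smul_sub, sub_eq_zero, ← he3, ← smul_assoc, smul_eq_mul,
      Finset.smul_sum] at hs'
    rw [pow_add, he2, hs']
    exact Finset.sum_congr rfl fun k _ => by rw [← smul_assoc, smul_eq_mul]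
  have h3 : (G.toExtension.σ (a ^ (e3 + e2)) • (⟨f, hf⟩ : G.toExtension.ker) -
      ∑ k, G.toExtension.σ (a ^ e3 * u k) • x k).val ∈ G.toExtension.ker ^ 2 := by
    rw [← Algebra.Extension.Cotangent.mk_eq_zero_iff, map_sub, map_sum, sub_eq_zero,
      ← smul_mk_eq_mk_σ_smul]
    simp_rw [← smul_mk_eq_mk_σ_smul]
    exact h2
  refine ⟨e3 + e2, fun e he => ?_⟩
  have h4 : G.toExtension.σ a ^ (e3 + e2) * f =
      (G.toExtension.σ a ^ (e3 + e2) - G.toExtension.σ (a ^ (e3 + e2))) * f +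
      (G.toExtension.σ (a ^ (e3 + e2)) • (⟨f, hf⟩ : G.toExtension.ker) -
        ∑ k, G.toExtension.σ (a ^ e3 * u k) • x k).val +
      ∑ k, G.toExtension.σ (a ^ e3 * u k) * (x k).val := by
    simp only [Submodule.coe_sub, Submodule.coe_sum, Submodule.coe_smul, smul_eq_mul]
    ring
  rw [← Nat.sub_add_cancel he, pow_add, mul_assoc, h4]
  refine Ideal.mul_mem_left _ _ (Ideal.add_mem _ (Ideal.add_mem _ ?_ ?_) ?_)
  · refine Ideal.mem_sup_right ?_
    rw [pow_two]
    exact Ideal.mul_mem_mul (σ_pow_sub_σ_pow_mem_ker G.toExtension a (e3 + e2)) hf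
  · exact Ideal.mem_sup_right h3
  · refine Ideal.mem_sup_left (Ideal.sum_mem _ fun k _ => Ideal.mul_mem_left _ _ ?_)
    exact Ideal.subset_span ⟨k, rfl⟩

set_option backward.isDefEq.respectTransparency false in
/-- Clearing denominators in the left inverse: a matrix `ψ` over `A` with
`ψ · (∂x_j/∂x_i) = a^E · 1` (Stacks 07EZ, proof of (e): "writing this left inverse in terms of
the basis `f_1, …, f_c` and clearing denominators we find `ψ₀ : A^{⊕ n+r} → A^{⊕ c}` such that
… is multiplication by `a^{e_0}`"). [cite: StacksProject, Tag 07EZ] -/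
theorem exists_matrix_mul_jacobian [Fintype ι] [Algebra.FormallySmooth R (Localization.Away a)]
    {c : ℕ} (x : Fin c → G.toExtension.ker)
    (b : Module.Basis (Fin c) (Localization.Away a) (LocCot G a))
    (hb : ∀ k, b k = (1 : Localization.Away a) ⊗ₜ[A] Algebra.Extension.Cotangent.mk (x k)) :
    ∃ (E : ℕ) (ψ : Fin c → ι → A), ∀ k j : Fin c,
      ∑ i, ψ k i * aeval G.val (pderiv i (x j).val) = if j = k then a ^ E else 0 := by
  obtain ⟨σ, hσ⟩ := exists_sigma G a (R := R)
  -- `ψ₀ k i := b.repr (σ i) k` satisfies `∑ i (∂_i x_j) ψ₀ k i = δ_{jk}` in `A_a`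
  have h1 : ∀ k j : Fin c, ∑ i, algebraMap A (Localization.Away a)
      (aeval G.val (pderiv i (x j).val)) * b.repr (σ i) k = if j = k then 1 else 0 := by
    intro k j
    have := congrArg (fun m => b.repr m k) (hσ (x j))
    simp only [map_sum, map_smul, Finsupp.coe_finsetSum, Finset.sum_apply, Finsupp.smul_apply,
      smul_eq_mul] at this
    rw [← this, ← hb j, b.repr_self, Finsupp.single_apply]
  obtain ⟨s, hs⟩ := IsLocalization.exist_integer_multiples_of_finite (Submonoid.powers a)
    (fun ki : Fin c × ι => b.repr (σ ki.2) ki.1)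
  choose u hu using fun ki => RingHom.mem_rangeS.mp (hs ki)
  obtain ⟨e4, he4⟩ := (Submonoid.mem_powers_iff _ _).mp s.2
  -- `Δ k j := ∑ i u (k,i) ∂_i x_j - δ_{jk} s` maps to zero in `A_a`
  have h2 : ∀ kj : Fin c × Fin c, ∃ n : ℕ, a ^ n * (∑ i, u (kj.1, i) *
      aeval G.val (pderiv i (x kj.2).val) - if kj.2 = kj.1 then (s : A) else 0) = 0 := by
    rintro ⟨k, j⟩
    have hz : algebraMap A (Localization.Away a) (∑ i, u (k, i) *
        aeval G.val (pderiv i (x j).val) - if j = k then (s : A) else 0) = 0 := by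
      rw [map_sub, map_sum]
      simp_rw [map_mul, hu, smul_mul_assoc, ← Finset.smul_sum]
      simp_rw [mul_comm (b.repr (σ _) k)]
      rw [h1 k j]
      split_ifs
      · rw [Algebra.smul_def, mul_one, sub_self]
      · rw [smul_zero, map_zero, sub_self]
    obtain ⟨m, hm⟩ := (IsLocalization.map_eq_zero_iff (Submonoid.powers a)
      (Localization.Away a) _).mp hz
    obtain ⟨n, hn⟩ := (Submonoid.mem_powers_iff _ _).mp m.2
    exact ⟨n, by rw [hn]; exact hm⟩
  obtain ⟨n₀, hn₀⟩ := exists_pow_mul_eq_zero_of_forall a _ h2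
  refine ⟨n₀ + e4, fun k i => a ^ n₀ * u (k, i), fun k j => ?_⟩
  have h3 := hn₀ (k, j)
  rw [mul_sub, sub_eq_zero, Finset.mul_sum] at h3
  simp only at h3
  simp_rw [mul_assoc]
  rw [h3]
  split_ifs
  · rw [← he4, pow_add]
  · rw [mul_zero]

variable {G a} in
/-- Rescaling a basis of `(J/J²)_a` so that it consists of elements `1 ⊗ x̄_k`, `x_k ∈ J`
(Stacks 07EZ, proof of (e): "Choose `f_1, …, f_c ∈ J` which map to a basis of `(J/J²)_a`").
[cite: StacksProject, Tag 07EZ] -/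
theorem exists_basis_tmul_mk {c : ℕ}
    (b : Module.Basis (Fin c) (Localization.Away a) (LocCot G a)) :
    ∃ (x : Fin c → G.toExtension.ker)
      (b' : Module.Basis (Fin c) (Localization.Away a) (LocCot G a)),
      ∀ k, b' k = (1 : Localization.Away a) ⊗ₜ[A] Algebra.Extension.Cotangent.mk (x k) := by
  have hsurj := fun k => IsLocalizedModule.surj (Submonoid.powers a)
    (TensorProduct.mk A (Localization.Away a) G.toExtension.Cotangent 1) (b k)
  choose ms hms using hsurj
  choose z hz using fun k => Algebra.Extension.Cotangent.mk_surjective (ms k).1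
  have hunit : ∀ k, IsUnit (algebraMap A (Localization.Away a) ((ms k).2 : A)) :=
    fun k => IsLocalization.map_units _ (ms k).2
  refine ⟨z, b.unitsSMul fun k => (hunit k).unit, fun k => ?_⟩
  rw [Module.Basis.unitsSMul_apply, Units.smul_def, IsUnit.unit_spec, algebraMap_smul,
    ← Submonoid.smul_def, hms k, TensorProduct.mk_apply, hz]

set_option backward.isDefEq.respectTransparency false in
/-- Stacks 07EZ (e) when `A_a ≠ 0` (the main case). [cite: StacksProject, Tag 07EZ] -/
theorem isStrictlyStandard_pow_of_nontrivial [Algebra.FinitePresentation R A] (a : A)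
    [Algebra.FormallySmooth R (Localization.Away a)]
    [Module.IsStablyFree (Localization.Away a) (Ω[Localization.Away a⁄R])]
    [Nontrivial (Localization.Away a)] :
    ∃ e₀ : ℕ, ∀ e, e₀ ≤ e → IsStrictlyStandard R (a ^ e) := by
  classical
  -- a finite presentation `P₀` of `A` with `n` generators (Stacks: `A = R[x_1, …, x_n]/I`)
  obtain ⟨n, m₀, ⟨P₀⟩⟩ := Algebra.Presentation.exists_presentation_fin R A
  -- `(I/I²)_a ⊕ A_a^r` is free (Stacks: "`(I/I²)_a` is stably free")
  obtain ⟨r, hr⟩ := exists_free_locCot_prod_pi P₀.toGenerators a (R := R)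
  -- enlarged generators `G`: `J = (I, x_{n+1}, …, x_{n+r})`, `(J/J²)_a` free
  obtain ⟨G, hGfree⟩ : ∃ G : Algebra.Generators R A (Fin (n + r)),
      Module.Free (Localization.Away a) (LocCot G a) :=
    ⟨extendZero P₀.toGenerators r, free_locCot_extendZero P₀.toGenerators r a hr⟩
  haveI : Module.Finite A G.toExtension.Cotangent :=
    Algebra.Extension.Cotangent.finite G.fg_ker_of_finitePresentation
  haveI : Module.Finite A G.toExtension.CotangentSpace :=
    Module.Finite.of_basis G.cotangentSpaceBasis
  -- a basis `1 ⊗ x̄_1, …, 1 ⊗ x̄_c` of `(J/J²)_a` with `x_k ∈ J`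
  obtain ⟨c, b₀⟩ : Σ c : ℕ, Module.Basis (Fin c) (Localization.Away a) (LocCot G a) :=
    ⟨_, Module.finBasis _ _⟩
  obtain ⟨x, b, hb⟩ := exists_basis_tmul_mk b₀
  -- generators `g_1, …, g_t` of `J`
  obtain ⟨t, g, hg⟩ :=
    Submodule.fg_iff_exists_fin_generating_family.mp G.fg_ker_of_finitePresentation
  have hgmem : ∀ j, g j ∈ G.ker := fun j => hg ▸ Submodule.subset_span ⟨j, rfl⟩
  -- the presentation `A = R[x_1, …, x_{n+r}]/(x_1, …, x_c, g_1, …, g_t)`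
  let rel : Fin (c + t) → G.Ring := Fin.append (fun k => (x k).val) g
  have hrel_left : ∀ k, rel (Fin.castAdd t k) = (x k).val := fun k => Fin.append_left _ _ k
  have hrel_right : ∀ j, rel (Fin.natAdd c j) = g j := fun j => Fin.append_right _ _ j
  have hspan : Ideal.span (Set.range rel) = G.ker := by
    apply le_antisymm
    · rw [Ideal.span_le]
      rintro _ ⟨j, rfl⟩
      induction j using Fin.addCases with
      | left k => rw [hrel_left]; exact (x k).2
      | right j => rw [hrel_right]; exact hgmem j
    · intro f hf
      rw [← hg] at hf
      refine Submodule.span_mono ?_ hf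
      rintro _ ⟨j, rfl⟩
      exact ⟨Fin.natAdd c j, hrel_right j⟩
  let Pf : Algebra.Presentation R A (Fin (n + r)) (Fin (c + t)) :=
    { toGenerators := G, relation := rel, span_range_relation_eq_ker := hspan }
  have hcm : c ≤ c + t := Nat.le_add_right c t
  have hcn : c ≤ n + r := by
    have h1 := LinearMap.finrank_le_finrank_of_injective (dL_injective G a (R := R))
    rw [Module.finrank_eq_card_basis b, Module.finrank_eq_card_basis
      (G.cotangentSpaceBasis.baseChange (Localization.Away a)), Fintype.card_fin,
      Fintype.card_fin] at h1
    exact h1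
  have hcast : ∀ k : Fin c, Fin.castLE hcm k = Fin.castAdd t k := fun k => Fin.ext rfl
  have hrel_castLE : ∀ k, Pf.relation (Fin.castLE hcm k) = (x k).val := fun k => by
    change rel (Fin.castLE hcm k) = _
    rw [hcast, hrel_left]
  -- (16.2.3.4) for large powers
  have h34 : ∀ j : Fin t, ∃ E : ℕ, ∀ e, E ≤ e → G.σ a ^ e * g j ∈
      Ideal.span (Set.range fun k => (x k).val) ⊔ G.ker ^ 2 := fun j =>
    exists_pow_mul_mem_span_sup G a x b hb (g j) (hgmem j)
  choose E hE using h34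
  -- (16.2.3.3) for large powers
  obtain ⟨E', ψ, hψ⟩ := exists_matrix_mul_jacobian G a x b hb (R := R)
  have hmat : (Matrix.of ψ) * (Matrix.of fun i j => aeval G.val (pderiv i (x j).val)) =
      a ^ E' • (1 : Matrix (Fin c) (Fin c) A) := by
    ext k j
    rw [Matrix.mul_apply, Matrix.smul_apply, Matrix.one_apply, smul_eq_mul, mul_ite, mul_one,
      mul_zero]
    simp only [Matrix.of_apply]
    rw [hψ k j]
    exact if_congr eq_comm rfl rfl
  have hpow := pow_eq_sum_minors_of_mul_eq _ _ _ hmat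
  have hminor : ∀ p : Fin c → Fin (n + r),
      (Matrix.of fun i j => (Matrix.of fun i j => aeval G.val (pderiv i (x j).val)) (p i) j).det
        = aeval Pf.val (jacobianMinor Pf.relation hcm p) := by
    intro p
    rw [jacobianMinor, AlgHom.map_det, AlgHom.mapMatrix_apply]
    congr 1
    ext i j
    simp only [Matrix.of_apply, Matrix.map_apply, hrel_castLE]
    rfl
  refine ⟨E' * c + ∑ j, E j, fun e he => ⟨n + r, c + t, Pf, c, hcn, hcm, ?_, ?_⟩⟩
  · -- (16.2.3.3)
    have he1 : E' * c ≤ e := le_trans (Nat.le_add_right _ _) he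
    refine ⟨fun p => a ^ (e - E' * c) * ∏ i, ψ i (p i), ?_⟩
    rw [show a ^ e = a ^ (e - E' * c) * (a ^ E') ^ c by
      rw [← pow_mul, ← pow_add, Nat.sub_add_cancel he1], hpow, Finset.mul_sum]
    refine Finset.sum_congr rfl fun p _ => ?_
    rw [hminor p, mul_assoc]
    simp only [Matrix.of_apply]
  · -- (16.2.3.4)
    refine liftCond_of_exists (G.σ a ^ e) (by rw [map_pow, G.aeval_val_σ]) fun j hj => ?_
    obtain ⟨j', rfl⟩ : ∃ j' : Fin t, Fin.natAdd c j' = j :=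
      ⟨⟨j - c, by omega⟩, Fin.ext (by simp only [Fin.natAdd_mk]; omega)⟩
    have he2 : E j' ≤ e := le_trans (le_trans
      (Finset.single_le_sum (fun _ _ => Nat.zero_le _) (Finset.mem_univ j'))
      (Nat.le_add_left _ _)) he
    have hx : Set.range (Pf.relation ∘ Fin.castLE hcm) = Set.range fun k => (x k).val := by
      congr 1
      funext k
      exact hrel_castLE k
    have hrelj : Pf.relation (Fin.natAdd c j') = g j' := hrel_right j'
    rw [hx, hrelj]
    exact hE j' e he2

end Assembly

end Stacks07EZ

section Public

variable {R A : Type u} [CommRing R] [CommRing A] [Algebra R A]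

open Stacks07EZ

/-- **Stacks, Lemma 07EZ (e)** (= Lemma 16.3.7 (e) of *Smoothing Ring Maps*): let `R → A` be
of finite presentation and `a ∈ A` such that `A_a` is smooth over `R` and `Ω_{A_a/R}` is stably
free (condition (2)); then the elements `a^e`, `e ≥ e₀`, are strictly standard in `A` over
`R` (Definition 07C7, `IsStrictlyStandard`). We assume only formal smoothness of `A_a` (which,
`A` being of finite presentation, is the same as smoothness). Proof as in loc. cit.: split
exactness of `0 → (I/I²)_a → ⊕ A_a dx_i → Ω_{A_a/R} → 0`, `(I/I²)_a` stably free, dummy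
generators make `(J/J²)_a` free on `f_1, …, f_c ∈ J`, clearing denominators gives (16.2.3.4)
for `a^e` and a matrix `ψ₀` with `ψ₀ ∘ (∂f_j/∂x_i) = a^{e₀}`, whence (16.2.3.3) for `a^{ce₀}`
by Lemma 07ET (Cauchy–Binet, Algebra 07DQ). [cite: StacksProject, Tag 07EZ] -/
theorem Stacks07EZ_isStrictlyStandard_pow [Algebra.FinitePresentation R A] (a : A)
    [Algebra.FormallySmooth R (Localization.Away a)]
    [Module.IsStablyFree (Localization.Away a) (Ω[Localization.Away a⁄R])] :
    ∃ e₀ : ℕ, ∀ e, e₀ ≤ e → IsStrictlyStandard R (a ^ e) := by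
  rcases subsingleton_or_nontrivial (Localization.Away a) with h | h
  · have h0 : (0 : A) ∈ Submonoid.powers a :=
      (IsLocalization.subsingleton_iff (M := Submonoid.powers a) (S := Localization.Away a)).mp h
    obtain ⟨n, hn⟩ := (Submonoid.mem_powers_iff _ _).mp h0
    exact isStrictlyStandard_pow_of_isNilpotent ⟨n, hn⟩
  · exact isStrictlyStandard_pow_of_nontrivial a

/-- **Stacks, Lemma 07EZ, (3) ⇒ (e)**: if `A_a` is smooth over `R` with `Ω_{A_a/R}` free, then
`a^e` is strictly standard in `A` over `R` for all large `e` (the form used in the proof of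
Lemma 07FE: "`C_{x_i}` is a smooth `R`-algebra with `Ω_{C_{x_i}/R}` free. Hence we can find
`c > 0` such that `x_i^c` is strictly standard in `C/R`"). [cite: StacksProject, Tag 07EZ] -/
theorem Stacks07EZ_isStrictlyStandard_pow_of_free [Algebra.FinitePresentation R A] (a : A)
    [Algebra.Smooth R (Localization.Away a)]
    [Module.Free (Localization.Away a) (Ω[Localization.Away a⁄R])] :
    ∃ e₀ : ℕ, ∀ e, e₀ ≤ e → IsStrictlyStandard R (a ^ e) :=
  haveI : Algebra.FormallySmooth R (Localization.Away a) := Algebra.Smooth.formallySmooth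
  Stacks07EZ_isStrictlyStandard_pow a

/-- A single exponent: some power of `a` is strictly standard. [cite: StacksProject, Tag 07EZ] -/
theorem Stacks07EZ_exists_isStrictlyStandard_pow [Algebra.FinitePresentation R A] (a : A)
    [Algebra.FormallySmooth R (Localization.Away a)]
    [Module.IsStablyFree (Localization.Away a) (Ω[Localization.Away a⁄R])] :
    ∃ e : ℕ, 0 < e ∧ IsStrictlyStandard R (a ^ e) := by
  obtain ⟨e₀, h⟩ := Stacks07EZ_isStrictlyStandard_pow a (R := R)
  exact ⟨e₀ + 1, Nat.succ_pos _, h _ (Nat.le_succ _)⟩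

end Public

end Literature.AlgebraicGeometry.Resolution

end
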